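import Literature.NumberTheory.Automorphic.LevelActionReductionKernel
import Literature.NumberTheory.Automorphic.LevelActionSectionsExact
import Literature.Algebra.Homology.GroupCohomologyTorsionBound
import Literature.Algebra.Homology.GroupCohomologySemilinearBijective
import HarnessLib

/-!
# A uniform bound for the `ϖ`-torsion of `H¹(U, V)` in the coefficients-at-`p` model

Topic `NumberTheory/Automorphic`; namespace `Literature.NumberTheory.Automorphic.LevelAction`;
definitions with bodies and theorems (no named fact, no `sorry`); universe `0` as in
`LevelActionSectionsExact`.  Let `τ : Δ → End_S V` be a coefficient system over a
commutative ring `S`, `ϖ ∈ S` and `m` with `ϖ^{m+1} = 0`, such that on `V`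

  `ker (ϖ^m ·) = ϖ V`  and  `V[ϖ] = ϖ^m V`

(e.g. `V` free over `S = 𝒪/ϖ^{m+1}`, `𝒪` a discrete valuation ring), and let `φ : V → V'` be a
surjective `σ`-semilinear equivariant map onto a coefficient system `τ'` over `S'` with
`ker φ = ϖ V` (e.g. reduction modulo `ϖ`).  Then for a level `U ⊆ Δ`:

* `exists_smul_eq_of_pow_smul_eq_zero`, `exists_pow_smul_eq_of_smul_eq_zero` — the two displayed
  identities persist on sections `M(U, V)` (values on coset representatives are free);
* `bijective_modSMulToTorsion` — `ϖ^m` induces an isomorphism of representations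
  `M(U,V)/ϖ ≅ M(U,V)[ϖ]`;
* `bijective_modSMulToSections` — `φ` induces a `σ`-semilinear equivariant bijection
  `M(U,V)/ϖ ≅ M(U,V')`;
* **`finite_torsionBy_cohomology_one`** — hence, by `GroupCohomologyTorsionBound`,

    **`#H¹(U, V)[ϖ] ≤ #H¹(U, V') · #H⁰(U, V')`**, finite when the right side is.

Applied to `V = ⨂_τ Sym^{k−2}((𝒪/pⁿ)²)`, `ϖ = p`, `V' =` the lattice modulo `p`, this bounds the
`p`-torsion of `H¹` with coefficients modulo `pⁿ` independently of `n` — an input of Hida's control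
theorem in degree `1` ([Hida1994AIF, §3]; [KhareThorne2017, §6.4–6.5]).

## References

* H. Hida, Ann. Inst. Fourier 44 (1994), §3 (held). [Hida1994AIF]
* C. Khare, J. A. Thorne, Amer. J. Math. 139 (2017), §6.4–6.5 (arXiv:1409.7007, held). [KhareThorne2017]
* K. S. Brown, *Cohomology of Groups*, GTM 87 (1982), III.6 (held). [Brown1982CohomologyGroups]
-/

noncomputable section

open CategoryTheory Literature.Algebra.Homology
open scoped Pointwise

namespace Literature.NumberTheory.Automorphic.LevelAction

variable {S S' : Type} [CommRing S] [CommRing S'] {σ : S →+* S'} {Γ 𝒢 : Type} [Group Γ] [Group 𝒢]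
  (ι : Γ →* 𝒢) (Δ : Submonoid 𝒢) {V V' : Type} [AddCommGroup V] [Module S V] [AddCommGroup V']
  [Module S' V'] (τ : Δ →* Module.End S V) (τ' : Δ →* Module.End S' V') (U : Subgroup 𝒢)
  (hU : U.toSubmonoid ≤ Δ) (ϖ : S) (m : ℕ)

/-! ### Scalar endomorphisms are equivariant -/

/-- `c · id` commutes with the action. [folklore] -/
theorem smul_id_comp_eq (c : S) (δ : Δ) :
    (c • LinearMap.id : V →ₗ[S] V) ∘ₗ τ δ = τ δ ∘ₗ (c • LinearMap.id : V →ₗ[S] V) :=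
  LinearMap.ext fun v => by simp

/-- The push-forward of `c · id` is `c ·` on sections. [folklore] -/
theorem pushforward_smul_id_hom_apply (c : S) (f : sections Δ τ U) :
    (pushforward ι Δ τ τ U (c • LinearMap.id) (smul_id_comp_eq Δ τ c)).hom f = c • f :=
  rfl

/-! ### Lifting the two identities to sections -/

include ι hU in
/-- **`ker (ϖ^m ·) = ϖ M(U, V)` on sections** if it holds on `V`. [folklore] -/
theorem exists_smul_eq_of_pow_smul_eq_zero (hker : ∀ x : V, ϖ ^ m • x = 0 ↔ ∃ y, ϖ • y = x)
    (f : sections Δ τ U) (hf : ϖ ^ m • f = 0) : ∃ f₀ : sections Δ τ U, ϖ • f₀ = f := by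
  have hex : Function.Exact (ϖ • LinearMap.id : V →ₗ[S] V) (ϖ ^ m • LinearMap.id : V →ₗ[S] V) := fun x => by
    rw [LinearMap.smul_apply, LinearMap.id_apply, hker, Set.mem_range]
    rfl
  obtain ⟨f₀, hf₀⟩ := pushforward_exact ι τ τ τ hU (ϖ • LinearMap.id) (ϖ ^ m • LinearMap.id)
    (smul_id_comp_eq Δ τ ϖ) (smul_id_comp_eq Δ τ (ϖ ^ m)) hex f
    (by rw [pushforward_smul_id_hom_apply]; exact hf)
  exact ⟨f₀, by rw [← pushforward_smul_id_hom_apply ι Δ τ U ϖ f₀]; exact hf₀⟩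

include ι hU in
/-- **`M(U, V)[ϖ] = ϖ^m M(U, V)` on sections** if it holds on `V`. [folklore] -/
theorem exists_pow_smul_eq_of_smul_eq_zero (htor : ∀ x : V, ϖ • x = 0 ↔ ∃ y, ϖ ^ m • y = x)
    (f : sections Δ τ U) (hf : ϖ • f = 0) : ∃ f₀ : sections Δ τ U, ϖ ^ m • f₀ = f := by
  have hex : Function.Exact (ϖ ^ m • LinearMap.id : V →ₗ[S] V) (ϖ • LinearMap.id : V →ₗ[S] V) := fun x => by
    rw [LinearMap.smul_apply, LinearMap.id_apply, htor, Set.mem_range]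
    rfl
  obtain ⟨f₀, hf₀⟩ := pushforward_exact ι τ τ τ hU (ϖ ^ m • LinearMap.id) (ϖ • LinearMap.id)
    (smul_id_comp_eq Δ τ (ϖ ^ m)) (smul_id_comp_eq Δ τ ϖ) hex f
    (by rw [pushforward_smul_id_hom_apply]; exact hf)
  exact ⟨f₀, by rw [← pushforward_smul_id_hom_apply ι Δ τ U (ϖ ^ m) f₀]; exact hf₀⟩

/-! ### `M(U,V)/ϖ ≅ M(U,V)[ϖ]` -/

section ModSMulToTorsion

/-- `ϖ^m f` is `ϖ`-torsion. [folklore] -/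
theorem pow_smul_mem_torsionBy (hnil : ϖ ^ (m + 1) = 0) (f : sections Δ τ U) :
    (ϖ ^ m • LinearMap.id : sections Δ τ U →ₗ[S] sections Δ τ U) f ∈
      Submodule.torsionBy S (Rep.of (rep ι Δ τ U)).V ϖ := by
  rw [Submodule.mem_torsionBy_iff, LinearMap.smul_apply, LinearMap.id_apply, ← mul_smul, ← pow_succ', hnil, zero_smul]

/-- `ϖ M(U,V) ⊆ ker (ϖ^m ·)`. [folklore] -/
theorem smul_top_le_ker_pow_smul (hnil : ϖ ^ (m + 1) = 0) :
    (ϖ • ⊤ : Submodule S (Rep.of (rep ι Δ τ U)).V) ≤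
      LinearMap.ker (LinearMap.codRestrict (Submodule.torsionBy S (Rep.of (rep ι Δ τ U)).V ϖ)
        (ϖ ^ m • LinearMap.id : sections Δ τ U →ₗ[S] sections Δ τ U) (pow_smul_mem_torsionBy ι Δ τ U ϖ m hnil)) := by
  intro f hf
  obtain ⟨f₀, -, rfl⟩ := (Submodule.mem_smul_pointwise_iff_exists _ _ _).1 hf
  rw [LinearMap.mem_ker]
  refine Subtype.ext ?_
  change ϖ ^ m • ϖ • f₀ = 0
  rw [← mul_smul, ← pow_succ, hnil, zero_smul]

/-- **`M(U,V)/ϖ → M(U,V)[ϖ]`, `[f] ↦ ϖ^m f`.** [folklore] -/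
def modSMulToTorsion (hnil : ϖ ^ (m + 1) = 0) :
    (modSMulRep (Rep.of (rep ι Δ τ U)) ϖ).V →ₗ[S] (torsionRep (Rep.of (rep ι Δ τ U)) ϖ).V :=
  (ϖ • ⊤ : Submodule S (Rep.of (rep ι Δ τ U)).V).liftQ
    (LinearMap.codRestrict (Submodule.torsionBy S (Rep.of (rep ι Δ τ U)).V ϖ)
      (ϖ ^ m • LinearMap.id : sections Δ τ U →ₗ[S] sections Δ τ U) (pow_smul_mem_torsionBy ι Δ τ U ϖ m hnil))
    (smul_top_le_ker_pow_smul ι Δ τ U ϖ m hnil)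

/-- Unfolding. [folklore] -/
theorem modSMulToTorsion_mk (hnil : ϖ ^ (m + 1) = 0) (f : sections Δ τ U) :
    (modSMulToTorsion ι Δ τ U ϖ m hnil (Submodule.Quotient.mk f) : sections Δ τ U) = ϖ ^ m • f :=
  rfl

/-- Equivariance. [folklore] -/
theorem modSMulToTorsion_equivariant (hnil : ϖ ^ (m + 1) = 0) (γ : Γ) (q : (modSMulRep (Rep.of (rep ι Δ τ U)) ϖ).V) :
    modSMulToTorsion ι Δ τ U ϖ m hnil ((modSMulRep (Rep.of (rep ι Δ τ U)) ϖ).ρ γ q) =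
      (torsionRep (Rep.of (rep ι Δ τ U)) ϖ).ρ γ (modSMulToTorsion ι Δ τ U ϖ m hnil q) := by
  induction q using Submodule.Quotient.induction_on with
  | _ f =>
    refine Subtype.ext ?_
    change ϖ ^ m • rep ι Δ τ U γ f = rep ι Δ τ U γ (ϖ ^ m • f)
    rw [map_smul]

include hU in
/-- **`M(U,V)/ϖ ≅ M(U,V)[ϖ]`** when `ker (ϖ^m ·) = ϖ V` and `V[ϖ] = ϖ^m V` on `V`. [folklore] -/
theorem bijective_modSMulToTorsion (hnil : ϖ ^ (m + 1) = 0) (hker : ∀ x : V, ϖ ^ m • x = 0 ↔ ∃ y, ϖ • y = x)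
    (htor : ∀ x : V, ϖ • x = 0 ↔ ∃ y, ϖ ^ m • y = x) :
    Function.Bijective (modSMulToTorsion ι Δ τ U ϖ m hnil) := by
  constructor
  · refine (injective_iff_map_eq_zero _).2 fun q hq => ?_
    induction q using Submodule.Quotient.induction_on with
    | _ f =>
      have hf : ϖ ^ m • f = 0 := by
        have h := congrArg Subtype.val hq
        rwa [modSMulToTorsion_mk] at h
      obtain ⟨f₀, rfl⟩ := exists_smul_eq_of_pow_smul_eq_zero ι Δ τ U hU ϖ m hker f hf
      exact (Submodule.Quotient.mk_eq_zero _).2 (Submodule.smul_mem_pointwise_smul _ _ _ Submodule.mem_top)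
  · rintro ⟨f, hf⟩
    obtain ⟨f₀, rfl⟩ := exists_pow_smul_eq_of_smul_eq_zero ι Δ τ U hU ϖ m htor f
      ((Submodule.mem_torsionBy_iff _ _).1 hf)
    exact ⟨Submodule.Quotient.mk f₀, Subtype.ext (modSMulToTorsion_mk ι Δ τ U ϖ m hnil f₀)⟩

end ModSMulToTorsion

/-! ### `M(U,V)/ϖ ≅ M(U,V')` along `φ` -/

section ModSMulToSections

variable (φ : V →ₛₗ[σ] V') (hφ : ∀ (δ : Δ) (v : V), φ (τ δ v) = τ' δ (φ v))
  (hkerφ : ∀ x : V, φ x = 0 ↔ ∃ y, ϖ • y = x)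

include hkerφ in
/-- `ϖ M(U,V) ⊆ ker M(U, φ)`. [folklore] -/
theorem smul_top_le_ker_sectionsSemimap :
    (ϖ • ⊤ : Submodule S (Rep.of (rep ι Δ τ U)).V) ≤ LinearMap.ker (sectionsSemimap Δ τ τ' U hU φ hφ) := by
  intro f hf
  obtain ⟨f₀, -, rfl⟩ := (Submodule.mem_smul_pointwise_iff_exists _ _ _).1 hf
  rw [LinearMap.mem_ker]
  refine Subtype.ext (funext fun g => ?_)
  rw [coe_sectionsSemimap_apply]
  exact (hkerφ _).2 ⟨f₀.1 g, rfl⟩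

/-- **`M(U,V)/ϖ → M(U,V')`** induced by `φ`. [folklore] -/
def modSMulToSections : (modSMulRep (Rep.of (rep ι Δ τ U)) ϖ).V →ₛₗ[σ] sections Δ τ' U :=
  (ϖ • ⊤ : Submodule S (Rep.of (rep ι Δ τ U)).V).liftQ (sectionsSemimap Δ τ τ' U hU φ hφ)
    (smul_top_le_ker_sectionsSemimap ι Δ τ τ' U hU ϖ φ hφ hkerφ)

/-- Unfolding. [folklore] -/
theorem modSMulToSections_mk (f : sections Δ τ U) :
    modSMulToSections ι Δ τ τ' U hU ϖ φ hφ hkerφ (Submodule.Quotient.mk f) = sectionsSemimap Δ τ τ' U hU φ hφ f :=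
  rfl

/-- Equivariance. [folklore] -/
theorem modSMulToSections_equivariant (γ : Γ) (q : (modSMulRep (Rep.of (rep ι Δ τ U)) ϖ).V) :
    modSMulToSections ι Δ τ τ' U hU ϖ φ hφ hkerφ ((modSMulRep (Rep.of (rep ι Δ τ U)) ϖ).ρ γ q) =
      (Rep.of (rep ι Δ τ' U)).ρ γ (modSMulToSections ι Δ τ τ' U hU ϖ φ hφ hkerφ q) := by
  induction q using Submodule.Quotient.induction_on with
  | _ f => exact sectionsSemimap_rep ι Δ τ τ' U hU φ hφ γ f

include hU in
/-- **`M(U,V)/ϖ ≅ M(U,V')`** for `φ` surjective with `ker φ = ϖV`, when `ker (ϖ^m ·) = ϖV` on `V` and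
`ϖ^{m+1} = 0`. [folklore] -/
theorem bijective_modSMulToSections (hnil : ϖ ^ (m + 1) = 0) (hker : ∀ x : V, ϖ ^ m • x = 0 ↔ ∃ y, ϖ • y = x)
    (hsurj : Function.Surjective φ) :
    Function.Bijective (modSMulToSections ι Δ τ τ' U hU ϖ φ hφ hkerφ) := by
  constructor
  · refine (injective_iff_map_eq_zero _).2 fun q hq => ?_
    induction q using Submodule.Quotient.induction_on with
    | _ f =>
      rw [modSMulToSections_mk] at hq
      -- the values of `f` lie in `ϖ V`, so `ϖ^m f = 0`, so `f ∈ ϖ M(U, V)`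
      have hf : ϖ ^ m • f = 0 := by
        refine Subtype.ext (funext fun g => ?_)
        have hg : φ (f.1 g) = 0 := by
          have h := congrArg (fun s : sections Δ τ' U => s.1 g) hq
          simpa only [coe_sectionsSemimap_apply, ZeroMemClass.coe_zero, Pi.zero_apply] using h
        obtain ⟨y, hy⟩ := (hkerφ _).1 hg
        change ϖ ^ m • f.1 g = 0
        rw [← hy, ← mul_smul, ← pow_succ, hnil, zero_smul]
      obtain ⟨f₀, rfl⟩ := exists_smul_eq_of_pow_smul_eq_zero ι Δ τ U hU ϖ m hker f hf
      exact (Submodule.Quotient.mk_eq_zero _).2 (Submodule.smul_mem_pointwise_smul _ _ _ Submodule.mem_top)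
  · intro f'
    obtain ⟨f, rfl⟩ := sectionsSemimap_surjective Δ τ τ' U hU φ hφ hsurj f'
    exact ⟨Submodule.Quotient.mk f, rfl⟩

end ModSMulToSections

/-! ### The bound -/

include hU in
/-- **`#H¹(U, V)[ϖ] ≤ #H¹(U, V') · #H⁰(U, V')`** (finite when the right side is), for `ϖ^{m+1} = 0`,
`ker (ϖ^m ·) = ϖV`, `V[ϖ] = ϖ^m V` on `V`, and `φ : V ↠ V'` equivariant `σ`-semilinear with
`ker φ = ϖ V`. [cite: Hida1994AIF, §3] [cite: Brown1982CohomologyGroups, III.6 Prop. 6.1] -/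
theorem finite_torsionBy_cohomology_one (hnil : ϖ ^ (m + 1) = 0)
    (hker : ∀ x : V, ϖ ^ m • x = 0 ↔ ∃ y, ϖ • y = x) (htor : ∀ x : V, ϖ • x = 0 ↔ ∃ y, ϖ ^ m • y = x)
    (φ : V →ₛₗ[σ] V') (hφ : ∀ (δ : Δ) (v : V), φ (τ δ v) = τ' δ (φ v))
    (hkerφ : ∀ x : V, φ x = 0 ↔ ∃ y, ϖ • y = x) (hsurj : Function.Surjective φ)
    [Finite (cohomology ι Δ τ' U 1)] [Finite (cohomology ι Δ τ' U 0)] :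
    Finite (Submodule.torsionBy S (cohomology ι Δ τ U 1) ϖ) ∧
      Nat.card (Submodule.torsionBy S (cohomology ι Δ τ U 1) ϖ) ≤
        Nat.card (cohomology ι Δ τ' U 1) * Nat.card (cohomology ι Δ τ' U 0) := by
  set A : Rep S Γ := Rep.of (rep ι Δ τ U) with hA
  -- `Hⁿ(M(U,V)/ϖ) ≅ Hⁿ(M(U,V'))`
  have hb₂ : ∀ n, Function.Bijective (semimap (A := modSMulRep A ϖ) (B := Rep.of (rep ι Δ τ' U))
      (modSMulToSections ι Δ τ τ' U hU ϖ φ hφ hkerφ) (modSMulToSections_equivariant ι Δ τ τ' U hU ϖ φ hφ hkerφ) n) :=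
    fun n => semimap_bijective_of_bijective _ _ (bijective_modSMulToSections ι Δ τ τ' U hU ϖ m φ hφ hkerφ hnil hker hsurj) n
  -- `Hⁿ(M(U,V)/ϖ) ≅ Hⁿ(M(U,V)[ϖ])`
  have hb₁ : ∀ n, Function.Bijective (semimap (σ := RingHom.id S) (A := modSMulRep A ϖ) (B := torsionRep A ϖ)
      (modSMulToTorsion ι Δ τ U ϖ m hnil) (modSMulToTorsion_equivariant ι Δ τ U ϖ m hnil) n) :=
    fun n => semimap_bijective_of_bijective _ _ (bijective_modSMulToTorsion ι Δ τ U hU ϖ m hnil hker htor) n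
  haveI h0 : Finite (groupCohomology (modSMulRep A ϖ) 0) := Finite.of_injective _ (hb₂ 0).1
  haveI h1 : Finite (groupCohomology (modSMulRep A ϖ) 1) := Finite.of_injective _ (hb₂ 1).1
  haveI h1' : Finite (groupCohomology (torsionRep A ϖ) 1) := Finite.of_surjective _ (hb₁ 1).2
  have hc0 : Nat.card (groupCohomology (modSMulRep A ϖ) 0) = Nat.card (cohomology ι Δ τ' U 0) :=
    Nat.card_eq_of_bijective _ (hb₂ 0)
  have hc1 : Nat.card (groupCohomology (torsionRep A ϖ) 1) = Nat.card (cohomology ι Δ τ' U 1) :=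
    (Nat.card_eq_of_bijective _ (hb₁ 1)).symm.trans (Nat.card_eq_of_bijective _ (hb₂ 1))
  obtain ⟨hfin, hcard⟩ := finite_torsionBy_groupCohomology_one A ϖ
  rw [hc0, hc1] at hcard
  exact ⟨hfin, hcard⟩

end Literature.NumberTheory.Automorphic.LevelAction
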